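import Summits.QuantumFields.YangMills.Theorems.UnitScaleTiltProp7PinnedFlatPassage
import Summits.QuantumFields.YangMills.Theorems.UnitScaleTiltProp7FibreQDefectEll2
import HarnessLib

/-!
# Route `UnitScaleTilt`, crux K1 child «MinimiserStabilityRegPr» (stmt-QuantumFields-19200), route-R GROWTH (MAP #3 M10, S3 «nonlinear passage») — THE FLAT PINNED NONLINEAR
# (ii′) ON THE FIBRE: ★routeR-w1's F6 (`Prop7PinnedFlatPassage.relPoincare_pinnedOpt_flat_T3`, ✓ p609729) with its ONLY displayed datum — the averaging source
# `28ℓ·Σ_c|Q^{(K−n)}(W − 1)(c)|²_F` (M10(b)) — DISCHARGED by brick (b) in `ℓ²` (`Prop7FibreQDefectEll2.sum_normSq_linAvgIterM_sub_one_le_of_localReg_stencil`) for `W` in the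
# (0.4)-fibre of the trivial datum; what stays displayed is the interior mean-value input `C_reg` over an arbitrary stencil of overlap `ν` (local radii `ρ_c`)

Cell `ym3-torus`, keyed width hand `ym-routeR-w3` (D-0154 (3c); MAP #3 row M10).  THEOREMS ONLY (0 `def`, 0 `sorry`); `--supports stmt-QuantumFields-19200`, count-neutral.  YM₃ on T³ is a
ladder rung (R3), not the Clay problem; nothing here claims the stub, the crux, d = 4 or the mass gap.

WHAT (numbers).  ★★ `relPoincare_pinnedOpt_fibre_flat_T3`: `SU(2)`, `d = 3`, run `K`, height `n ≤ K`, `ℓ = L^{K−n}`, `C₁ = 33600L⁴∕(√L−1)² + 97∕8` (F6), `C₂ = 4·18³(2 + 4·18³)·5200(5L)²∕(L(L−1))`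
(the two-field constant at `d = 3`).  For `W` with `avg^{K−n}W = 1`, `ℓ²`-optimal on its pinned (4)-orbit relative to the flat background, `‖W_b − 1‖ ≤ s ≤ 1` globally and `≤ ρ_c ≤ s` on
the two `(K−n)`-blocks of each coarse bond `c`, the three smallness rows of the two-field theorem at `s`, a stencil relation `S c b` of overlap `ν` (`Σ_c𝟙[S c b] ≤ ν`; ★w1-19200 g6:
the mean-value input needs an ENLARGED neighbourhood — same-domain is not k-uniform even for lattice-harmonic data) and the displayed mean-value input `ρ_c² ≤ C_reg·ℓ⁻³·Σ_{b : S c b}‖W_b − 1‖²`: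
  `(1 − s²∕2 − 24576C₁ℓ²s²)·Σ_b‖W_b − 1‖² − 56ℓ·[(4C₂ℓ)²·(4ℓs)²·C_regℓ⁻³·ν·Σ_b‖W_b − 1‖²] ≤ 4C₁ℓ²·Σ_p‖W(∂p) − 1‖²`,
i.e. with `s = ε₂ℓ⁻¹`: `(1 − ε₂²∕2 − 24576C₁ε₂² − 14336·ν·C₂²C_reg·ε₂²)·Σ‖Y‖² ≤ 4C₁ℓ²·Σ_p‖R_p − 1‖²` — the RELATIVE POINCARÉ INEQUALITY (ii′) for the registered (pinned) representative at the
flat datum, NONLINEAR (true fibre, true optimum), k-UNIFORM for `ν` independent of `k`, with NO centre debit, NO structure rows, NO averaging source; the ONE displayed input is `C_reg`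
(the card §2(d) interior regularity of the optimal representative — OPEN, ★w1-19200 g6 (S3′) for flat linear data; it fails at charged centres, the S2″ fork).  Proof: F6 at `Q := linAvgIterM`
∘ Frobenius ≤ 2·op² ∘ brick (b) in `ℓ²` (stencil form).

References: T. Bałaban, CMP 102 (1985) 277–309 [Balaban1985Variational] (Prop. 7 p.299, (141)–(143) p.299); Commun. Math. Phys. 98 (1985) 17–51 [Balaban1985Averaging] (Prop. 4
(134)–(135) p.38, Prop. 5 (156)–(157) p.42); CMP 95 (1984) 17–40 [Balaban1984PropagatorsI] (Prop. 1.1 (1.90) p.33).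
-/

set_option autoImplicit false

noncomputable section

open scoped BigOperators Matrix.Norms.L2Operator Matrix

namespace Summit.QuantumFields.YangMills.Theorems.Prop7PinnedFlatFibrePassage

open Literature.MathematicalPhysics.QuantumFieldTheory.Balaban1983to89
open Literature.MathematicalPhysics.QuantumFieldTheory.Balaban1983to89.T3ContinuumYM3Torus
open Literature.MathematicalPhysics.QuantumFieldTheory.Balaban1983to89.T3PrintedRegularOrbits (descTransf)
open Literature.MathematicalPhysics.QuantumFieldTheory.Balaban1983to89.B5Eq118OneStroke (iterBlockOf)
open Finset B1RG242Torus
open T4Continuum B15DeterminingSets BlockAveraging ExpMeanLog BlockAveragingEMLLinearised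
open BlockAveragingEMLLinearisedBackground (pertVar)
open Summit.QuantumFields.YangMills.Theorems.LinearLiftMatrix (linAvgIterM linAvgIterM_zero linAvgIterM_succ)
open Summit.QuantumFields.YangMills.Theorems.Prop7CovariantCoercivity (sum_norm_sq_le_mul_opNorm_sq)
open Summit.QuantumFields.YangMills.Theorems.Prop7PinnedFlatPassage (relPoincare_pinnedOpt_flat_T3)
open Summit.QuantumFields.YangMills.Theorems.Prop7FibreQDefectEll2 (sum_normSq_linAvgIterM_sub_one_le_of_localReg_stencil)

variable (F : T3Family) {n K : ℕ} (h : n ≤ K)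

/-- Frobenius ≤ 2·operator², summed: `Σ_c Σ_jk |M_c,jk|² ≤ 2·Σ_c ‖M_c‖²` on `M₂(ℂ)`. [folklore] -/
theorem sum_normSq_le_two_mul_sum_norm_sq {ι : Type*} (S : Finset ι) (M : ι → Matrix (Fin 2) (Fin 2) ℂ) :
    ∑ c ∈ S, ∑ a : Fin 2, ∑ b' : Fin 2, Complex.normSq ((M c) a b') ≤ 2 * ∑ c ∈ S, ‖M c‖ ^ 2 := by
  rw [Finset.mul_sum]
  refine Finset.sum_le_sum fun c _ => ?_
  have h1 := sum_norm_sq_le_mul_opNorm_sq (M c)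
  have e : ∑ a : Fin 2, ∑ b' : Fin 2, Complex.normSq ((M c) a b') = ∑ a : Fin 2, ∑ b' : Fin 2, ‖(M c) a b'‖ ^ 2 :=
    Finset.sum_congr rfl fun a _ => Finset.sum_congr rfl fun b' _ => (Complex.sq_norm _).symm
  rw [e]
  exact_mod_cast h1

/-- ★★ **THE FLAT PINNED NONLINEAR (ii′) ON THE FIBRE, AVERAGING SOURCE DISCHARGED** (`SU(2)`, `d = 3`, `ℓ = L^{K−n}`, `C₁ = 33600L⁴∕(√L−1)² + 97∕8`, `C₂` the two-field constant):
`W` in the (0.4)-fibre of the trivial datum (`avg^{K−n}W = 1`) and `ℓ²`-optimal on its pinned (4)-orbit relative to the flat background; `‖W_b − 1‖ ≤ s ≤ 1`, local radii `ρ_c ≤ s` on the two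
blocks of `c`; smallness rows at `s`; a stencil relation `S` of overlap `ν`; mean-value input `ρ_c² ≤ C_reg·ℓ⁻³·Σ_{b : S c b}‖W_b − 1‖²` DISPLAYED.  THEN
`(1 − s²∕2 − 24576C₁ℓ²s²)·Σ_b‖W_b − 1‖² − 56ℓ·[(C₂·4ℓ)²·(4ℓ·s + 0)²·(C_reg·(ℓ³)⁻¹)·(ν·Σ_b‖W_b − 1‖²)] ≤ 4C₁ℓ²·Σ_p‖W(∂p) − 1‖²` — at `s = ε₂ℓ⁻¹` the left coefficient is
`1 − ε₂²∕2 − 24576C₁ε₂² − 14336νC₂²C_regε₂²`, k-UNIFORM; no centre debit, no structure rows, no averaging source. [cite: Balaban1985Variational, Prop. 7 p.299, (141)-(143) p.299;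
Balaban1985Averaging, Prop. 4 (134)–(135) p.38, Prop. 5 (156)–(157) p.42] -/
theorem relPoincare_pinnedOpt_fibre_flat_T3 (W : GaugeField (F.P K) 0 (Matrix.specialUnitaryGroup (Fin 2) ℂ))
    (hopt : ∀ v : GaugeTransf (F.P K) 0 (Matrix.specialUnitaryGroup (Fin 2) ℂ), descTransf F n K h v = (fun _ => 1) →
      ∑ b : PBond (F.P K) 0, ‖pertVar (fun _ => 1) W b‖ ^ 2 ≤ ∑ b : PBond (F.P K) 0, ‖pertVar (fun _ => 1) (GaugeField.gaugeAct v W) b‖ ^ 2)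
    (hfib : ∀ c : PBond (F.P K) (K - n), Averaging.iter (fun i => blockAvg (P := F.P K) (j := i) (expMeanLogSU (n := Fin 2))) (K - n) W c = 1)
    (S : PBond (F.P K) (K - n) → PBond (F.P K) 0 → Prop) [∀ c b, Decidable (S c b)] {ν : ℝ}
    (hν : ∀ b : PBond (F.P K) 0, ∑ c : PBond (F.P K) (K - n), (if S c b then (1 : ℝ) else 0) ≤ ν)
    {s Creg : ℝ} (hCreg : 0 ≤ Creg) (hδ : ∀ b : PBond (F.P K) 0, ‖((W b : Matrix.specialUnitaryGroup (Fin 2) ℂ) : Matrix (Fin 2) (Fin 2) ℂ) - 1‖ ≤ s) (hs1 : s ≤ 1)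
    (ρ : PBond (F.P K) (K - n) → ℝ) (hρ0 : ∀ c, 0 ≤ ρ c) (hρs : ∀ c, ρ c ≤ s)
    (hρ : ∀ (c : PBond (F.P K) (K - n)) (b : PBond (F.P K) 0), (iterBlockOf (K - n) b.src = c.src ∨ iterBlockOf (K - n) b.src = c.tgt) →
      (iterBlockOf (K - n) b.tgt = c.src ∨ iterBlockOf (K - n) b.tgt = c.tgt) → ‖((W b : Matrix.specialUnitaryGroup (Fin 2) ℂ) : Matrix (Fin 2) (Fin 2) ℂ) - 1‖ ≤ ρ c)
    (hreg : ∀ c : PBond (F.P K) (K - n), ρ c ^ 2 ≤ Creg * ((((F.P K).L : ℝ) ^ (K - n)) ^ 3)⁻¹ * ∑ b : PBond (F.P K) 0,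
        (if S c b then ‖((W b : Matrix.specialUnitaryGroup (Fin 2) ℂ) : Matrix (Fin 2) (Fin 2) ℂ) - 1‖ ^ 2 else 0))
    (h200 : 200 * ((((F.P K).d + 2) * (F.P K).L : ℕ) : ℝ) * ((((F.P K).d : ℝ) + 1) * ((F.P K).L : ℝ) ^ (K - n) * s) ≤ 1)
    (hm : ((((F.P K).d : ℝ) + 1) * ((18 : ℝ) ^ (F.P K).d * (2 + (((F.P K).d : ℝ) + 1) * (18 : ℝ) ^ (F.P K).d)) * (5200 * ((((F.P K).d + 2) * (F.P K).L : ℕ) : ℝ) ^ 2) /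
        (((F.P K).L : ℝ) * (((F.P K).L : ℝ) - 1))) * ((((F.P K).d : ℝ) + 1) * ((F.P K).L : ℝ) ^ (K - n) * s) ≤ 1)
    (hNδ : 4 * ((((F.P K).d + 2) * (F.P K).L : ℕ) : ℝ) * ((((F.P K).d : ℝ) + 1) * ((F.P K).L : ℝ) ^ (K - n) * s) < deltaSU (Fin 2)) :
    (1 - s ^ 2 / 2 - 24576 * (8400 * (2 : ℝ) ^ 2 * (F.L : ℝ) ^ 4 / (Real.sqrt F.L - 1) ^ 2 + 97 / 8) * ((F.L : ℝ) ^ (K - n)) ^ 2 * s ^ 2)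
        * ∑ b : PBond (F.P K) 0, ‖((W b : Matrix.specialUnitaryGroup (Fin 2) ℂ) : Matrix (Fin 2) (Fin 2) ℂ) - 1‖ ^ 2
      - 56 * (F.L : ℝ) ^ (K - n) *
        ((((((F.P K).d : ℝ) + 1) * ((18 : ℝ) ^ (F.P K).d * (2 + (((F.P K).d : ℝ) + 1) * (18 : ℝ) ^ (F.P K).d)) * (5200 * ((((F.P K).d + 2) * (F.P K).L : ℕ) : ℝ) ^ 2) /
            (((F.P K).L : ℝ) * (((F.P K).L : ℝ) - 1))) * ((((F.P K).d : ℝ) + 1) * ((F.P K).L : ℝ) ^ (K - n))) ^ 2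
          * (((((F.P K).d : ℝ) + 1) * ((F.P K).L : ℝ) ^ (K - n)) * s + 0) ^ 2 * (Creg * ((((F.P K).L : ℝ) ^ (K - n)) ^ 3)⁻¹)
          * (ν * ∑ b : PBond (F.P K) 0, ‖((W b : Matrix.specialUnitaryGroup (Fin 2) ℂ) : Matrix (Fin 2) (Fin 2) ℂ) - 1‖ ^ 2))
      ≤ 4 * (8400 * (2 : ℝ) ^ 2 * (F.L : ℝ) ^ 4 / (Real.sqrt F.L - 1) ^ 2 + 97 / 8) * ((F.L : ℝ) ^ (K - n)) ^ 2
          * ∑ p : Plaq (F.P K) 0, ‖((GaugeField.plaqHol W p : Matrix.specialUnitaryGroup (Fin 2) ℂ) : Matrix (Fin 2) (Fin 2) ℂ) - 1‖ ^ 2 := by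
  have hk : K - n ≤ (F.P K).m + (F.P K).K := by show K - n ≤ F.m + K; omega
  -- F6 at the concrete composite `linAvgIterM`
  have hF6 := relPoincare_pinnedOpt_flat_T3 F h W hopt linAvgIterM (fun Y => linAvgIterM_zero Y) (fun i Y c => linAvgIterM_succ i Y c)
    (fun b => ((W b : Matrix.specialUnitaryGroup (Fin 2) ℂ) : Matrix (Fin 2) (Fin 2) ℂ) - 1) (fun b => rfl) hδ hs1
  -- brick (b) in `ℓ²` at the flat datum
  have hD := sum_normSq_linAvgIterM_sub_one_le_of_localReg_stencil (P := F.P K) (n := Fin 2) hk W hfib S hν hCreg ρ hρ0 hρs hρ hreg h200 hm hNδ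
  -- Frobenius ≤ 2·op²
  have hFr := sum_normSq_le_two_mul_sum_norm_sq (Finset.univ : Finset (PBond (F.P K) (K - n)))
    (fun c => linAvgIterM (K - n) (fun b => ((W b : Matrix.specialUnitaryGroup (Fin 2) ℂ) : Matrix (Fin 2) (Fin 2) ℂ) - 1) c)
  have hLF : ((F.P K).L : ℝ) = (F.L : ℝ) := by norm_cast
  have hℓ0 : (0 : ℝ) ≤ (F.L : ℝ) ^ (K - n) := by positivity
  have h28 : 28 * (F.L : ℝ) ^ (K - n) * ∑ c : PBond (F.P K) (K - n), ∑ a : Fin 2, ∑ b' : Fin 2,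
        Complex.normSq ((linAvgIterM (K - n) (fun b => ((W b : Matrix.specialUnitaryGroup (Fin 2) ℂ) : Matrix (Fin 2) (Fin 2) ℂ) - 1) c) a b')
      ≤ 56 * (F.L : ℝ) ^ (K - n) *
        ((((((F.P K).d : ℝ) + 1) * ((18 : ℝ) ^ (F.P K).d * (2 + (((F.P K).d : ℝ) + 1) * (18 : ℝ) ^ (F.P K).d)) * (5200 * ((((F.P K).d + 2) * (F.P K).L : ℕ) : ℝ) ^ 2) /
            (((F.P K).L : ℝ) * (((F.P K).L : ℝ) - 1))) * ((((F.P K).d : ℝ) + 1) * ((F.P K).L : ℝ) ^ (K - n))) ^ 2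
          * (((((F.P K).d : ℝ) + 1) * ((F.P K).L : ℝ) ^ (K - n)) * s + 0) ^ 2 * (Creg * ((((F.P K).L : ℝ) ^ (K - n)) ^ 3)⁻¹)
          * (ν * ∑ b : PBond (F.P K) 0, ‖((W b : Matrix.specialUnitaryGroup (Fin 2) ℂ) : Matrix (Fin 2) (Fin 2) ℂ) - 1‖ ^ 2)) := by
    have h1 := mul_le_mul_of_nonneg_left (hFr.trans (mul_le_mul_of_nonneg_left hD (by norm_num))) (by positivity : (0 : ℝ) ≤ 28 * (F.L : ℝ) ^ (K - n))
    linarith [h1]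
  linarith [hF6, h28]

end Summit.QuantumFields.YangMills.Theorems.Prop7PinnedFlatFibrePassage

end
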